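import Summits.CriticalPhenomena.PercolationContinuityZ3.Theorems.PercNearOneGluingNoHeavyLowerTailSahiBlocksAllButOnePoly

/-!
# `NoHeavyLowerTail` (crux stmt-CriticalPhenomena-4575), Sahi / Kahn positivity: ALL BLOCKS BUT ONE (II) — the real block inequality

Support file (cell `prim-l12`, seat P3, gen 8; `--supports stmt-CriticalPhenomena-4575`).  No `sorry`, no named facts, standard axioms.
New mathematics (this programme).

The transport row (TC) of the all-blocks-but-one certificate (`…SahiBlocksAllButOne`), after the trace reduction and independence of the
blocks, is an inequality between polynomial expressions in the block odds `r_i` and the block states `(a_i, b_i, c_i)`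
(`x_i = P_i(1+a_i)`, `z_i = P_i(1+b_i)`, `y_i = P_i(1+c_i)`; `0 ≤ a_i, b_i ≤ r_i`, `c_i ≥ 0`, Harris `(1+a_i)(1+b_i) ≤ (1+c_i)(1+r_i)`):
`Npoly r a b c ≥ 0` (`Npoly_nonneg`).  PROOF.
* `Npoly` has degree `≤ 1` in each `a_j`, in each `b_j` and in each `c_j`, and `c_j` never multiplies `a_j, b_j`; its `c_j`-coefficient is
  `≥ 0` (the capacity inequality).  So for one block `j`, with the others fixed, `Npoly = g₀ + g₁a_j + g₂b_j + g₃a_jb_j + g₄c_j`, `g₄ ≥ 0`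
  (`Npoly_update`, `Npoly_convex`).
* For configurations of EXTREME blocks (`IsExt`: the corners `(0,0,0)`, `(r,r,r)` and the HYPERBOLA `(1+a)(1+b) = 1+r, c = 0`) the
  aggregates `σ₀,e₀ ∣ σ₃,e₃ ∣ α,e_A,β,e_B,γ` turn `Npoly` into `Π₀·A·B·M` with the core polynomial `M ≥ 0` of `…SahiBlocksAllButOnePoly`
  (`Npoly_nonneg_of_ext`).
The companion file `…SahiBlocksAllButOneDecomp` reduces every admissible configuration to extreme ones (explicit convex decomposition of a
block state along two rulings of the saddle `ab`, induction on the set of non-extreme blocks) and proves `Npoly ≥ 0` and the row (o). [this work]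
-/

noncomputable section

open scoped Classical

namespace Summit.CriticalPhenomena.PercolationContinuityZ3.Theorems

namespace SahiBlocksAllButOne

open Finset Function
open SahiAllButOne (one_add_sum_le_prod_one_add prod_one_add_mul_one_sub_sum_le_one)

variable {m : ℕ}

/-! ### The block polynomial -/

/-- `Σ_i a_i`. [this work] -/
def bsum (a : Fin m → ℝ) : ℝ := ∑ i, a i

/-- `∏_i (1 + a_i)`. [this work] -/
def bprod (a : Fin m → ℝ) : ℝ := ∏ i, (1 + a i)

/-- **The transport polynomial of a block configuration** (odds `r`, states `a, b, c`): `Π³σ·[tcRHS − θδρ]` in odds coordinates. [this work] -/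
def Npoly (r a b c : Fin m → ℝ) : ℝ :=
  bsum r * ((2 * bprod r - 1 - bsum r) * (1 + bsum c) * bprod r + (1 + bsum r) * (bprod a * bprod b)
      - bprod r * bprod a * (1 + bsum b) - bprod r * bprod b * (1 + bsum a))
    - (1 + bsum r) * (bprod r - 1 - bsum r) * bsum c * bprod r

/-- EXTREME block states for odds `ρ`: the two diagonal corners and the hyperbola. [this work] -/
def IsExt (ρ α β γ : ℝ) : Prop :=
  (α = 0 ∧ β = 0 ∧ γ = 0) ∨ (α = ρ ∧ β = ρ ∧ γ = ρ) ∨ ((1 + α) * (1 + β) = 1 + ρ ∧ γ = 0)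

/-- Admissible block states for odds `ρ`. [this work] -/
def Adm (ρ α β γ : ℝ) : Prop :=
  0 ≤ α ∧ α ≤ ρ ∧ 0 ≤ β ∧ β ≤ ρ ∧ 0 ≤ γ ∧ (1 + α) * (1 + β) ≤ (1 + γ) * (1 + ρ)

/-- Extreme states are admissible. [this work] -/
theorem adm_of_isExt {ρ α β γ : ℝ} (hρ : 0 ≤ ρ) (hα : 0 ≤ α) (hβ : 0 ≤ β) (h : IsExt ρ α β γ) : Adm ρ α β γ := by
  rcases h with ⟨rfl, rfl, rfl⟩ | ⟨rfl, rfl, rfl⟩ | ⟨hc, rfl⟩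
  · exact ⟨le_rfl, hρ, le_rfl, hρ, le_rfl, by nlinarith⟩
  · exact ⟨hρ, le_rfl, hρ, le_rfl, hρ, le_rfl⟩
  · refine ⟨hα, by nlinarith, hβ, by nlinarith, le_rfl, by nlinarith⟩

/-! ### Aggregation: extreme configurations -/

/-- `Σ_i a_i b_i ≤ (Σ a)(Σ b)` for nonnegative vectors. [folklore] -/
theorem sum_mul_le_sum_mul_sum (s : Finset (Fin m)) (a b : Fin m → ℝ) (ha : ∀ i, 0 ≤ a i) (hb : ∀ i, 0 ≤ b i) :
    ∑ i ∈ s, a i * b i ≤ (∑ i ∈ s, a i) * ∑ i ∈ s, b i := by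
  rw [sum_mul]
  refine sum_le_sum fun i hi => mul_le_mul_of_nonneg_left (single_le_sum (fun j _ => hb j) hi) (ha i)

set_option maxHeartbeats 1600000 in
/-- **Aggregation.**  For a configuration of EXTREME blocks the transport polynomial is `Π₀·A·B·M ≥ 0`. [this work] -/
theorem Npoly_nonneg_of_ext (r a b c : Fin m → ℝ) (hr : ∀ i, 0 ≤ r i) (ha : ∀ i, 0 ≤ a i) (hb : ∀ i, 0 ≤ b i)
    (hext : ∀ i, IsExt (r i) (a i) (b i) (c i)) : 0 ≤ Npoly r a b c := by
  -- the three kinds of blocks: `F0` free in both families, `F3` forced in both, `F4` on the hyperbola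
  set F0 := univ.filter fun i => a i = r i ∧ b i = r i ∧ c i = r i with hF0
  set R := univ.filter fun i => ¬ (a i = r i ∧ b i = r i ∧ c i = r i) with hR
  set F3 := R.filter fun i => a i = 0 ∧ b i = 0 ∧ c i = 0 with hF3
  set F4 := R.filter fun i => ¬ (a i = 0 ∧ b i = 0 ∧ c i = 0) with hF4
  have hcurve : ∀ i ∈ F4, (1 + a i) * (1 + b i) = 1 + r i ∧ c i = 0 := by
    intro i hi
    have h1 := (mem_filter.1 hi).2
    have h2 := (mem_filter.1 (mem_filter.1 hi).1).2
    rcases hext i with h | h | h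
    · exact (h1 h).elim
    · exact (h2 h).elim
    · exact h
  have m0 : ∀ i ∈ F0, a i = r i ∧ b i = r i ∧ c i = r i := fun i hi => (mem_filter.1 hi).2
  have m3 : ∀ i ∈ F3, a i = 0 ∧ b i = 0 ∧ c i = 0 := fun i hi => (mem_filter.1 hi).2
  -- splitting sums and products
  have split_sum : ∀ f : Fin m → ℝ, ∑ i, f i = (∑ i ∈ F0, f i) + ((∑ i ∈ F3, f i) + ∑ i ∈ F4, f i) := by
    intro f
    rw [← sum_filter_add_sum_filter_not univ (fun i => a i = r i ∧ b i = r i ∧ c i = r i),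
      ← sum_filter_add_sum_filter_not R (fun i => a i = 0 ∧ b i = 0 ∧ c i = 0)]
  have split_prod : ∀ f : Fin m → ℝ, ∏ i, f i = (∏ i ∈ F0, f i) * ((∏ i ∈ F3, f i) * ∏ i ∈ F4, f i) := by
    intro f
    rw [← prod_filter_mul_prod_filter_not univ (fun i => a i = r i ∧ b i = r i ∧ c i = r i),
      ← prod_filter_mul_prod_filter_not R (fun i => a i = 0 ∧ b i = 0 ∧ c i = 0)]
  -- the pieces
  have hF4r : ∑ i ∈ F4, r i = (∑ i ∈ F4, a i) + (∑ i ∈ F4, b i) + (∑ i ∈ F4, a i * b i) := by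
    rw [← sum_add_distrib, ← sum_add_distrib]
    exact sum_congr rfl fun i hi => by linear_combination (-1 : ℝ) * (hcurve i hi).1
  have hF4p : ∏ i ∈ F4, (1 + r i) = (∏ i ∈ F4, (1 + a i)) * (∏ i ∈ F4, (1 + b i)) := by
    rw [← prod_mul_distrib]
    exact prod_congr rfl fun i hi => (hcurve i hi).1.symm
  have hF0a : ∑ i ∈ F0, a i = (∑ i ∈ F0, r i) := sum_congr rfl fun i hi => (m0 i hi).1
  have hF0b : ∑ i ∈ F0, b i = (∑ i ∈ F0, r i) := sum_congr rfl fun i hi => (m0 i hi).2.1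
  have hF0c : ∑ i ∈ F0, c i = (∑ i ∈ F0, r i) := sum_congr rfl fun i hi => (m0 i hi).2.2
  have hF3a : ∑ i ∈ F3, a i = 0 := sum_eq_zero fun i hi => (m3 i hi).1
  have hF3b : ∑ i ∈ F3, b i = 0 := sum_eq_zero fun i hi => (m3 i hi).2.1
  have hF3c : ∑ i ∈ F3, c i = 0 := sum_eq_zero fun i hi => (m3 i hi).2.2
  have hF4c : ∑ i ∈ F4, c i = 0 := sum_eq_zero fun i hi => (hcurve i hi).2
  have hF0pa : ∏ i ∈ F0, (1 + a i) = (∏ i ∈ F0, (1 + r i)) := prod_congr rfl fun i hi => by rw [(m0 i hi).1]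
  have hF0pb : ∏ i ∈ F0, (1 + b i) = (∏ i ∈ F0, (1 + r i)) := prod_congr rfl fun i hi => by rw [(m0 i hi).2.1]
  have hF3pa : ∏ i ∈ F3, (1 + a i) = 1 := prod_eq_one fun i hi => by rw [(m3 i hi).1, add_zero]
  have hF3pb : ∏ i ∈ F3, (1 + b i) = 1 := prod_eq_one fun i hi => by rw [(m3 i hi).2.1, add_zero]
  -- the aggregates of `Npoly`
  have e_sr : bsum r = (∑ i ∈ F0, r i) + ((∑ i ∈ F3, r i) + ((∑ i ∈ F4, a i) + (∑ i ∈ F4, b i) + (∑ i ∈ F4, a i * b i))) := by rw [bsum, split_sum, hF4r]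
  have e_pr : bprod r = (∏ i ∈ F0, (1 + r i)) * ((∏ i ∈ F3, (1 + r i)) * ((∏ i ∈ F4, (1 + a i)) * (∏ i ∈ F4, (1 + b i)))) := by rw [bprod, split_prod, hF4p]
  have e_sa : bsum a = (∑ i ∈ F0, r i) + (0 + (∑ i ∈ F4, a i)) := by rw [bsum, split_sum, hF0a, hF3a]
  have e_sb : bsum b = (∑ i ∈ F0, r i) + (0 + (∑ i ∈ F4, b i)) := by rw [bsum, split_sum, hF0b, hF3b]
  have e_sc : bsum c = (∑ i ∈ F0, r i) + (0 + 0) := by rw [bsum, split_sum, hF0c, hF3c, hF4c]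
  have e_pa : bprod a = (∏ i ∈ F0, (1 + r i)) * (1 * (∏ i ∈ F4, (1 + a i))) := by rw [bprod, split_prod, hF0pa, hF3pa]
  have e_pb : bprod b = (∏ i ∈ F0, (1 + r i)) * (1 * (∏ i ∈ F4, (1 + b i))) := by rw [bprod, split_prod, hF0pb, hF3pb]
  -- nonnegativity and the relations `e = Π − 1 − σ ≥ 0`, `γ ≤ αβ`
  have hs0p : 0 ≤ (∑ i ∈ F0, r i) := sum_nonneg fun i _ => hr i
  have hs3p : 0 ≤ (∑ i ∈ F3, r i) := sum_nonneg fun i _ => hr i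
  have halp : 0 ≤ (∑ i ∈ F4, a i) := sum_nonneg fun i _ => ha i
  have hbep : 0 ≤ (∑ i ∈ F4, b i) := sum_nonneg fun i _ => hb i
  have hgap : 0 ≤ (∑ i ∈ F4, a i * b i) := sum_nonneg fun i _ => mul_nonneg (ha i) (hb i)
  have he0 : 0 ≤ (∏ i ∈ F0, (1 + r i)) - 1 - (∑ i ∈ F0, r i) := by linarith [one_add_sum_le_prod_one_add F0 r fun i _ => hr i]
  have he3 : 0 ≤ (∏ i ∈ F3, (1 + r i)) - 1 - (∑ i ∈ F3, r i) := by linarith [one_add_sum_le_prod_one_add F3 r fun i _ => hr i]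
  have heA : 0 ≤ (∏ i ∈ F4, (1 + a i)) - 1 - (∑ i ∈ F4, a i) := by linarith [one_add_sum_le_prod_one_add F4 a fun i _ => ha i]
  have heB : 0 ≤ (∏ i ∈ F4, (1 + b i)) - 1 - (∑ i ∈ F4, b i) := by linarith [one_add_sum_le_prod_one_add F4 b fun i _ => hb i]
  have hgab : (∑ i ∈ F4, a i * b i) ≤ (∑ i ∈ F4, a i) * (∑ i ∈ F4, b i) := sum_mul_le_sum_mul_sum F4 a b ha hb
  have hA0 : 0 ≤ (∏ i ∈ F4, (1 + a i)) := prod_nonneg fun i _ => by linarith [ha i]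
  have hB0 : 0 ≤ (∏ i ∈ F4, (1 + b i)) := prod_nonneg fun i _ => by linarith [hb i]
  have hP00 : 0 ≤ (∏ i ∈ F0, (1 + r i)) := prod_nonneg fun i _ => by linarith [hr i]
  have core := blocks_core_nonneg (∑ i ∈ F0, r i) ((∏ i ∈ F0, (1 + r i)) - 1 - (∑ i ∈ F0, r i)) (∑ i ∈ F3, r i) ((∏ i ∈ F3, (1 + r i)) - 1 - (∑ i ∈ F3, r i)) (∑ i ∈ F4, a i) ((∏ i ∈ F4, (1 + a i)) - 1 - (∑ i ∈ F4, a i)) (∑ i ∈ F4, b i) ((∏ i ∈ F4, (1 + b i)) - 1 - (∑ i ∈ F4, b i)) (∑ i ∈ F4, a i * b i)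
    hs0p he0 hs3p he3 halp heA hbep heB hgap hgab
  have key : Npoly r a b c = (∏ i ∈ F0, (1 + r i)) * (∏ i ∈ F4, (1 + a i)) * (∏ i ∈ F4, (1 + b i)) *
      ((((∑ i ∈ F0, r i))+((∑ i ∈ F3, r i))+((∑ i ∈ F4, a i))+((∑ i ∈ F4, b i))+((∑ i ∈ F4, a i * b i))) * ((2*((1+((∑ i ∈ F0, r i))+((∏ i ∈ F0, (1 + r i)) - 1 - (∑ i ∈ F0, r i)))*(1+((∑ i ∈ F3, r i))+((∏ i ∈ F3, (1 + r i)) - 1 - (∑ i ∈ F3, r i)))*(1+((∑ i ∈ F4, a i))+((∏ i ∈ F4, (1 + a i)) - 1 - (∑ i ∈ F4, a i)))*(1+((∑ i ∈ F4, b i))+((∏ i ∈ F4, (1 + b i)) - 1 - (∑ i ∈ F4, b i)))) - 1 - (((∑ i ∈ F0, r i))+((∑ i ∈ F3, r i))+((∑ i ∈ F4, a i))+((∑ i ∈ F4, b i))+((∑ i ∈ F4, a i * b i))))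
        * (1+((∑ i ∈ F0, r i))) * (1+((∑ i ∈ F3, r i))+((∏ i ∈ F3, (1 + r i)) - 1 - (∑ i ∈ F3, r i))) + (1+(((∑ i ∈ F0, r i))+((∑ i ∈ F3, r i))+((∑ i ∈ F4, a i))+((∑ i ∈ F4, b i))+((∑ i ∈ F4, a i * b i)))) * (1+((∑ i ∈ F0, r i))+((∏ i ∈ F0, (1 + r i)) - 1 - (∑ i ∈ F0, r i)))
        - (1+((∑ i ∈ F0, r i))+((∏ i ∈ F0, (1 + r i)) - 1 - (∑ i ∈ F0, r i)))*(1+((∑ i ∈ F3, r i))+((∏ i ∈ F3, (1 + r i)) - 1 - (∑ i ∈ F3, r i)))*((1+((∑ i ∈ F4, a i))+((∏ i ∈ F4, (1 + a i)) - 1 - (∑ i ∈ F4, a i)))*(1+((∑ i ∈ F0, r i))+((∑ i ∈ F4, b i))) + (1+((∑ i ∈ F4, b i))+((∏ i ∈ F4, (1 + b i)) - 1 - (∑ i ∈ F4, b i)))*(1+((∑ i ∈ F0, r i))+((∑ i ∈ F4, a i)))))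
      - (1+(((∑ i ∈ F0, r i))+((∑ i ∈ F3, r i))+((∑ i ∈ F4, a i))+((∑ i ∈ F4, b i))+((∑ i ∈ F4, a i * b i)))) * ((1+((∑ i ∈ F0, r i))+((∏ i ∈ F0, (1 + r i)) - 1 - (∑ i ∈ F0, r i)))*(1+((∑ i ∈ F3, r i))+((∏ i ∈ F3, (1 + r i)) - 1 - (∑ i ∈ F3, r i)))*(1+((∑ i ∈ F4, a i))+((∏ i ∈ F4, (1 + a i)) - 1 - (∑ i ∈ F4, a i)))*(1+((∑ i ∈ F4, b i))+((∏ i ∈ F4, (1 + b i)) - 1 - (∑ i ∈ F4, b i))) - 1 - (((∑ i ∈ F0, r i))+((∑ i ∈ F3, r i))+((∑ i ∈ F4, a i))+((∑ i ∈ F4, b i))+((∑ i ∈ F4, a i * b i))))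
        * ((∑ i ∈ F0, r i)) * (1+((∑ i ∈ F3, r i))+((∏ i ∈ F3, (1 + r i)) - 1 - (∑ i ∈ F3, r i)))) := by
    rw [Npoly, e_sr, e_pr, e_sa, e_sb, e_sc, e_pa, e_pb]; ring
  rw [key]
  exact mul_nonneg (mul_nonneg (mul_nonneg hP00 hA0) hB0) core

/-! ### One block: update formulas, the convex step -/

/-- `Σ` after updating one block. [this work] -/
theorem bsum_update (a : Fin m → ℝ) (j : Fin m) (α : ℝ) : bsum (update a j α) = α + ∑ i ∈ univ.erase j, a i := by
  rw [bsum, ← add_sum_erase univ _ (mem_univ j), update_self]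
  congr 1
  exact sum_congr rfl fun i hi => by rw [update_of_ne (ne_of_mem_erase hi)]

/-- `∏(1+·)` after updating one block. [this work] -/
theorem bprod_update (a : Fin m → ℝ) (j : Fin m) (α : ℝ) : bprod (update a j α) = (1 + α) * ∏ i ∈ univ.erase j, (1 + a i) := by
  rw [bprod, ← mul_prod_erase univ _ (mem_univ j), update_self]
  congr 1
  exact prod_congr rfl fun i hi => by rw [update_of_ne (ne_of_mem_erase hi)]

/-- **The transport polynomial is affine in one block's `(a_j, b_j, a_jb_j, c_j)`**: explicit form. [this work] -/
theorem Npoly_update (r a b c : Fin m → ℝ) (j : Fin m) (α β γ : ℝ) :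
    Npoly r (update a j α) (update b j β) (update c j γ) =
      bsum r * ((2 * bprod r - 1 - bsum r) * (1 + (γ + ∑ i ∈ univ.erase j, c i)) * bprod r
          + (1 + bsum r) * (((1 + α) * ∏ i ∈ univ.erase j, (1 + a i)) * ((1 + β) * ∏ i ∈ univ.erase j, (1 + b i)))
          - bprod r * ((1 + α) * ∏ i ∈ univ.erase j, (1 + a i)) * (1 + (β + ∑ i ∈ univ.erase j, b i))
          - bprod r * ((1 + β) * ∏ i ∈ univ.erase j, (1 + b i)) * (1 + (α + ∑ i ∈ univ.erase j, a i)))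
        - (1 + bsum r) * (bprod r - 1 - bsum r) * (γ + ∑ i ∈ univ.erase j, c i) * bprod r := by
  rw [Npoly, bsum_update, bsum_update, bsum_update, bprod_update, bprod_update]

/-- **The convex step.**  A convex combination of three block states with the same means of `a_j, b_j, a_jb_j` and of `c_j` gives the
same combination of values of the transport polynomial. [this work] -/
theorem Npoly_convex (r a b c : Fin m → ℝ) (j : Fin m) (l1 l2 l3 α1 β1 γ1 α2 β2 γ2 α3 β3 γ3 α β γ : ℝ) (hl : l1 + l2 + l3 = 1)
    (hα : l1 * α1 + l2 * α2 + l3 * α3 = α) (hβ : l1 * β1 + l2 * β2 + l3 * β3 = β)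
    (hαβ : l1 * (α1 * β1) + l2 * (α2 * β2) + l3 * (α3 * β3) = α * β) (hγ : l1 * γ1 + l2 * γ2 + l3 * γ3 = γ) :
    l1 * Npoly r (update a j α1) (update b j β1) (update c j γ1) + l2 * Npoly r (update a j α2) (update b j β2) (update c j γ2)
      + l3 * Npoly r (update a j α3) (update b j β3) (update c j γ3) = Npoly r (update a j α) (update b j β) (update c j γ) := by
  simp only [Npoly_update]
  set S := bsum r
  set P := bprod r
  set PA := ∏ i ∈ univ.erase j, (1 + a i)
  set PB := ∏ i ∈ univ.erase j, (1 + b i)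
  set SA := ∑ i ∈ univ.erase j, a i
  set SB := ∑ i ∈ univ.erase j, b i
  set SC := ∑ i ∈ univ.erase j, c i
  linear_combination (S * ((2*P - 1 - S) * (1 + SC) * P + (1 + S) * (PA * PB) - P * PA * (1 + SB) - P * PB * (1 + SA))
      - (1 + S) * (P - 1 - S) * SC * P) * hl
    + (S * ((1 + S) * (PA * PB) - P * PA * (1 + SB) - P * PB)) * hα
    + (S * ((1 + S) * (PA * PB) - P * PA - P * PB * (1 + SA))) * hβ
    + (S * ((1 + S) * (PA * PB) - P * PA - P * PB)) * hαβ
    + (S * (2*P - 1 - S) * P - (1 + S) * (P - 1 - S) * P) * hγ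

/-- The `c_j`-coefficient is nonnegative: the capacity inequality `(1+σ)(Π−1−σ) ≤ (2Π−1−σ)σ`. [this work] -/
theorem ccoef_nonneg (r : Fin m → ℝ) (hr : ∀ i, 0 ≤ r i) :
    0 ≤ bsum r * (2 * bprod r - 1 - bsum r) * bprod r - (1 + bsum r) * (bprod r - 1 - bsum r) * bprod r := by
  have hσ : 0 ≤ bsum r := sum_nonneg fun i _ => hr i
  have hPi : 1 + bsum r ≤ bprod r := one_add_sum_le_prod_one_add univ r fun i _ => hr i
  have hPs : bprod r * (1 - bsum r) ≤ 1 := prod_one_add_mul_one_sub_sum_le_one univ r fun i _ => hr i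
  have ha : (1 + bsum r) * (bprod r - 1 - bsum r) ≤ (2 * bprod r - 1 - bsum r) * bsum r := by nlinarith [hPs, hσ, hPi]
  have hP : 0 ≤ bprod r := by linarith
  nlinarith [mul_le_mul_of_nonneg_right ha hP]

/-- Monotonicity of the transport polynomial in one `c_j`. [this work] -/
theorem Npoly_mono_c (r a b c : Fin m → ℝ) (hr : ∀ i, 0 ≤ r i) (j : Fin m) {γ γ' : ℝ} (h : γ ≤ γ') :
    Npoly r a b (update c j γ) ≤ Npoly r a b (update c j γ') := by
  have e1 : Npoly r a b (update c j γ) = Npoly r (update a j (a j)) (update b j (b j)) (update c j γ) := by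
    rw [update_eq_self, update_eq_self]
  have e2 : Npoly r a b (update c j γ') = Npoly r (update a j (a j)) (update b j (b j)) (update c j γ') := by
    rw [update_eq_self, update_eq_self]
  rw [e1, e2, Npoly_update, Npoly_update]
  have hc := ccoef_nonneg r hr
  nlinarith [mul_le_mul_of_nonneg_left h hc]

end SahiBlocksAllButOne

end Summit.CriticalPhenomena.PercolationContinuityZ3.Theorems
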